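import Summits.HodgeConjecture.HodgeConjecture.Theorems.Ring2AtlasCMSixfolds
import Literature.AlgebraicGeometry.ComplexMultiplication.PrimitiveCMTypeSimple
import Literature.NumberTheory.ComplexMultiplication.CMTypeDictionary
import Literature.AlgebraicGeometry.Motives.ZarhinHodgeGroupAutC
import Mathlib.NumberTheory.Cyclotomic.PrimitiveRoots
import Mathlib.NumberTheory.NumberField.CMField
import Mathlib.NumberTheory.NumberField.Cyclotomic.Basic
import Mathlib.NumberTheory.NumberField.InfinitePlace.Embeddings
import Mathlib.RingTheory.RootsOfUnity.Complex
import Mathlib.Algebra.Algebra.Hom.Rat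
import HarnessLib

set_option linter.dupNamespace false

/-!
# Ring 2 · atlas-2 — carriers of the `Y₃ × Y₃'` non-vacuity witness: the primitive CM type `{1, 2, 4}` of `ℚ(ζ₉)`

HONEST FRAMING: research route conditional on HC_CM; not a corollary; Q11.4-sentence-2 already refuted in dim ≥ 3.

Cell `pub-hodge-ring2`, seat `pub-hodge-ring2-atlas-2` (generation 53). Second third of the non-vacuity proof
for the OPEN `g = 6` cell `HodgeUnitaryThreefoldPair` (`Ring2AtlasSixfolds` §3: `Y × Y'`, `Y, Y'` NON-ISOGENOUS
simple abelian threefolds with multiplication by the same `k = ℚ(√-d)`), companions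
`Ring2AtlasCMThreefoldsCyclotomic21` (the CM field `K ⊂ ℚ(ζ₂₁)` of `Y'`) and
`Ring2AtlasUnitaryThreefoldPairNonVacuity` (the witnesses and the cell theorems). This file supplies the CM field
and CM type of the factor `Y`: `ℚ(ζ₉)`, cyclic of degree `6` over `ℚ` (`(ℤ/9)^× = ⟨2⟩ ≅ ℤ/6`), containing
`ζ₃ = ζ₉³`, with the CM type `S = {φ₁, φ₂, φ₄}` (`φₐ : ζ ↦ ζ^a`; exponent set `T = {1, 2, 4} = {2⁰, 2¹, 2²}`, the
first half of the cyclic group `(ℤ/9)^×` in the generator `2` — Shimura's half-system, §8.4 Example (1) and its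
sequel for `F` cyclic over `ℚ` [held text `book:shimura1998-abelian-varieties-with-complex-multiplication-modular-functions`,
chunk p0085]). `T ⊔ 8T = (ℤ/9)^×` (`core_conj`: a CM type) and the stabiliser `{γ : γT = T}` is trivial
(`core_prim`, `decide +kernel`), so the type is PRIMITIVE (Shimura §8.2 Prop. 26: `H' = H₁ = {1}`); it is the type
`Φ₉` of `Pohlmann1968/ExceptionalHodgeClassesCMWeilType` («no `u ≠ 1` has `u · {1,2,4} = {1,2,4}`»), re-read here
on Mathlib's `CyclotomicField 9 ℚ` in the `Aut(ℂ)`-form that the tree's simplicity criterion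
`ComplexMultiplication.isSimple_of_isCMTypeRealisation_of_primitive` consumes (layout of `Cyclotomic13`,
generation 45, with units tracked by `Nat.Coprime · 9`).

Contents (namespace `Cyclotomic9`; every statement proved outright): `K9 := CyclotomicField 9 ℚ`, a CM field of
degree `6` (`finrank_K9`); `ζ := zeta 9`, `μ := e^{2πi/9}`, `conj μ = μ⁸`; embeddings ↔ exponents prime to `9`
(`exists_apply_ζ_eq`, `exists_embedding_apply_ζ_eq`, `ringHom_ext_ζ`), `Aut(ℂ)`-transitivity
(`exists_ringEquiv_comp_eq`); the type (`expT`, `typeSet`, `mem_typeSet_iff`, `typeSet_isCMType`, `Φ`), its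
primitivity (`core_prim`, `Φ_primitive`, `isPrimitive_Φ`); `ω := ζ³` is a primitive cube root of unity
(`isPrimitiveRoot_zeta3`), the source of `ψ = ι(2ω + 1)`, `ψ ≫ ψ = -3`.

WHAT THIS IS NOT: number-field bookkeeping only — no atlas word, cell `def`, KIND or count is touched and
nothing here mentions abelian varieties or Hodge classes.

References: [Shimura1998] G. Shimura, *Abelian Varieties with Complex Multiplication and Modular Functions*,
Princeton (1998), §8.2 Prop. 26 (p. 61), §8.4 Example (1) (p. 64); [Pohlmann1968] H. Pohlmann, Ann. of Math. 88
(1968), §2 (CM types of `ℚ(ζ₉)`).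
-/

noncomputable section

open Polynomial NumberField

namespace Summit.HodgeConjecture.HodgeConjecture.Ring2.Atlas

open Literature.AlgebraicGeometry Literature.AlgebraicGeometry.Motives
open Literature.AlgebraicGeometry.ComplexMultiplication
open Literature.NumberTheory.ComplexMultiplication

namespace Cyclotomic9

/-- The ninth cyclotomic field `ℚ(ζ₉)` (Mathlib's `CyclotomicField 9 ℚ`). [folklore] -/
abbrev K9 : Type := CyclotomicField 9 ℚ

/-- `ℚ(ζ₉)/ℚ` is the 9th cyclotomic extension (re-registered on the `DivisionRing.toRatAlgebra` path, as for
`Cyclotomic13.K13`). [folklore] -/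
instance instIsCyclotomicExtensionK9 : IsCyclotomicExtension {9} ℚ K9 :=
  CyclotomicField.isCyclotomicExtension 9 ℚ

/-- `ℚ(ζ₉)` is a CM field (a nontrivial cyclotomic extension of `ℚ`; Mathlib's
`IsCyclotomicExtension.Rat.isCMField`). [cite: Shimura1998, §8.4 Example (1), p. 64] -/
instance instIsCMFieldK9 : IsCMField K9 :=
  IsCyclotomicExtension.Rat.isCMField K9 (S := ({9} : Set ℕ)) ⟨9, Set.mem_singleton 9, by norm_num⟩

/-- The 9th cyclotomic polynomial is irreducible over `ℚ`. [folklore] -/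
theorem irreducible_cyclotomic9 : Irreducible (cyclotomic 9 ℚ) :=
  cyclotomic.irreducible_rat (by norm_num)

/-- `φ(9) = 6`. [folklore] -/
theorem totient_9 : Nat.totient 9 = 6 := by
  rw [show (9 : ℕ) = 3 ^ 2 by norm_num, Nat.totient_prime_pow Nat.prime_three (by norm_num)]
  norm_num

/-- `[ℚ(ζ₉) : ℚ] = φ(9) = 6`. [folklore] -/
theorem finrank_K9 : Module.finrank ℚ K9 = 6 := by
  rw [IsCyclotomicExtension.finrank (n := 9) K9 irreducible_cyclotomic9]
  exact totient_9

/-- The distinguished primitive 9th root of unity `ζ ∈ ℚ(ζ₉)`. [folklore] -/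
def ζ : K9 := IsCyclotomicExtension.zeta 9 ℚ K9

/-- `ζ` is a primitive 9th root of unity. [folklore] -/
theorem isPrimitiveRoot_ζ : IsPrimitiveRoot ζ 9 := IsCyclotomicExtension.zeta_spec 9 ℚ K9

/-- `μ = e^{2πi/9} ∈ ℂ`. [folklore] -/
def μ : ℂ := Complex.exp (2 * Real.pi * Complex.I / (9 : ℕ))

/-- `μ` is a primitive 9th root of unity in `ℂ`. [folklore] -/
theorem isPrimitiveRoot_μ : IsPrimitiveRoot μ 9 := Complex.isPrimitiveRoot_exp 9 (by norm_num)

/-- `μ⁹ = 1`. [folklore] -/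
theorem μ_pow_9 : μ ^ 9 = 1 := isPrimitiveRoot_μ.pow_eq_one

/-- Exponents of `μ` only matter mod `9`. [folklore] -/
theorem μ_pow_mod (n : ℕ) : μ ^ n = μ ^ (n % 9) := by
  conv_lhs => rw [← Nat.div_add_mod n 9]
  rw [pow_add, pow_mul, μ_pow_9, one_pow, one_mul]

/-- `μ^i = μ^j` with `i, j < 9` forces `i = j`. [folklore] -/
theorem μ_pow_inj {i j : ℕ} (hi : i < 9) (hj : j < 9) (h : μ ^ i = μ ^ j) : i = j :=
  isPrimitiveRoot_μ.pow_inj hi hj h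

/-- Complex conjugation inverts `μ`: `conj μ = μ⁸`. [folklore] -/
theorem conj_μ : starRingEnd ℂ μ = μ ^ 8 := by
  have h1 : ‖μ‖ = 1 := Complex.norm_eq_one_of_pow_eq_one μ_pow_9 (by norm_num)
  rw [← Complex.inv_eq_conj h1]
  have h2 : μ ^ 8 * μ = 1 := by rw [← pow_succ, μ_pow_9]
  exact inv_eq_of_mul_eq_one_left h2

/-- Every complex embedding of `ℚ(ζ₉)` sends `ζ` to `μ^a` for a unique `a < 9` prime to `9` (Shimura: «the
automorphisms of `ℚ(ζ)` are given by `ζ → ζ^a`»). [cite: Shimura1998, §8.4 Example (1), p. 64] -/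
theorem exists_apply_ζ_eq (s : K9 →+* ℂ) : ∃ a : ℕ, a < 9 ∧ a.Coprime 9 ∧ s ζ = μ ^ a := by
  have hprim : IsPrimitiveRoot (s ζ) 9 := isPrimitiveRoot_ζ.map_of_injective s.injective
  obtain ⟨i, hi, hiζ⟩ := isPrimitiveRoot_μ.eq_pow_of_pow_eq_one hprim.pow_eq_one
  refine ⟨i, hi, ?_, hiζ.symm⟩
  rw [← hiζ] at hprim
  exact (isPrimitiveRoot_μ.pow_iff_coprime (by norm_num) i).1 hprim

/-- For every `c` prime to `9` there is a complex embedding `ζ ↦ μ^c`. [folklore] -/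
theorem exists_embedding_apply_ζ_eq {c : ℕ} (hc : c.Coprime 9) : ∃ s : K9 →+* ℂ, s ζ = μ ^ c := by
  have hmem : μ ^ c ∈ primitiveRoots 9 ℂ :=
    (mem_primitiveRoots (by norm_num)).2 (isPrimitiveRoot_μ.pow_of_coprime c hc)
  refine ⟨((isPrimitiveRoot_ζ.embeddingsEquivPrimitiveRoots ℂ irreducible_cyclotomic9).symm
    ⟨μ ^ c, hmem⟩).toRingHom, ?_⟩
  have h := isPrimitiveRoot_ζ.embeddingsEquivPrimitiveRoots_apply_coe ℂ irreducible_cyclotomic9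
    ((isPrimitiveRoot_ζ.embeddingsEquivPrimitiveRoots ℂ irreducible_cyclotomic9).symm ⟨μ ^ c, hmem⟩)
  rw [Equiv.apply_symm_apply] at h
  exact h.symm

/-- A complex embedding of `ℚ(ζ₉)` is determined by the image of `ζ` (power basis). [folklore] -/
theorem ringHom_ext_ζ {s t : K9 →+* ℂ} (h : s ζ = t ζ) : s = t := by
  have key : s.toRatAlgHom = t.toRatAlgHom :=
    (isPrimitiveRoot_ζ.powerBasis ℚ).algHom_ext (by
      simpa [IsPrimitiveRoot.powerBasis_gen, RingHom.toRatAlgHom_apply] using h)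
  calc s = (s.toRatAlgHom : K9 →+* ℂ) := (RingHom.toRatAlgHom_toRingHom s).symm
    _ = (t.toRatAlgHom : K9 →+* ℂ) := by rw [key]
    _ = t := RingHom.toRatAlgHom_toRingHom t

/-- `Aut(ℂ)` is transitive on the complex embeddings of `ℚ(ζ₉)`. [folklore] -/
theorem exists_ringEquiv_comp_eq (s s' : K9 →+* ℂ) : ∃ τ : ℂ ≃+* ℂ, ∀ x, τ (s x) = s' x := by
  haveI : Countable K9 := Countable.of_equiv _ (Module.finBasis ℚ K9).equivFun.toEquiv.symm
  exact Motives.ZarhinLie.exists_ringEquiv_complex_comp_eq s s'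

/-! ### The CM type `S = {φ₁, φ₂, φ₄}` and its primitivity -/

/-- The exponent set `T = {1, 2, 4} ⊂ (ℤ/9)^×` of the type: the first half `{2⁰, 2¹, 2²}` of the cyclic group
`(ℤ/9)^× = ⟨2⟩` of order `6` (Shimura's half-system for a cyclic field; Pohlmann's `Φ₉`). Listed as residues.
[cite: Shimura1998, §8.4 Example (1), p. 64] -/
def expT : List ℕ := [1, 2, 4]

/-- `T ⊔ (−T) = (ℤ/9)^×`: for a unit `a`, exactly one of `a`, `−a ≡ 8a` lies in `T`. Decided by the kernel.
[folklore] -/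
theorem core_conj : ∀ a : ℕ, a < 9 → a.Coprime 9 → (a % 9 ∈ expT ↔ ¬ (8 * a) % 9 ∈ expT) := by
  decide

/-- `(ℤ/9)^×` is a group of order `6`: `a · (a⁵ b) ≡ b (mod 9)` for `a` prime to `9` (Euler). Decided by the
kernel. [folklore] -/
theorem core_inv : ∀ a : ℕ, a < 9 → a.Coprime 9 → ∀ b : ℕ, b < 9 → (a * (a ^ 5 * b % 9)) % 9 = b := by
  decide

/-- Products of units mod `9` are units. Decided by the kernel. [folklore] -/
theorem core_coprime : ∀ c : ℕ, c < 9 → c.Coprime 9 → ∀ a : ℕ, a < 9 → a.Coprime 9 → Nat.Coprime (c * a) 9 := by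
  decide

set_option synthInstance.maxSize 4096 in
set_option synthInstance.maxHeartbeats 400000 in
/-- **The arithmetic heart of primitivity** (Shimura's `H' = H₁`, §8.2 Prop. 26, here `H₁ = {1}`): if two units
`a, b` mod `9` satisfy `ca ∈ T ⟺ cb ∈ T` for every unit `c`, then `a = b` — the stabiliser `{γ : γT = T}` of
`T = {1, 2, 4}` in `(ℤ/9)^×` is trivial. Decided by the kernel on the residue table.
[cite: Shimura1998, §8.2 Prop. 26, p. 61; §8.4 Example (1), p. 64] -/
theorem core_prim : ∀ a : ℕ, a < 9 → a.Coprime 9 → ∀ b : ℕ, b < 9 → b.Coprime 9 →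
    (∀ c : ℕ, c < 9 → c.Coprime 9 → ((c * a) % 9 ∈ expT ↔ (c * b) % 9 ∈ expT)) → a = b := by
  decide +kernel

/-- **The type** `S ⊂ Hom(ℚ(ζ₉), ℂ)`: the embeddings `ζ ↦ μ^a` with `a ∈ T = {1, 2, 4}`.
[cite: Shimura1998, §8.4 Example (1), p. 64] -/
def typeSet : Set (K9 →+* ℂ) := {s | ∃ a : ℕ, a < 9 ∧ s ζ = μ ^ a ∧ a ∈ expT}

/-- Membership in the type is read off the exponent mod `9`. [folklore] -/
theorem mem_typeSet_iff {s : K9 →+* ℂ} {n : ℕ} (hs : s ζ = μ ^ n) : s ∈ typeSet ↔ n % 9 ∈ expT := by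
  constructor
  · rintro ⟨a, ha, hsa, haT⟩
    have hmod : n % 9 = a :=
      μ_pow_inj (Nat.mod_lt _ (by norm_num)) ha (by rw [← μ_pow_mod, ← hs, hsa])
    rw [hmod]
    exact haT
  · intro hT
    exact ⟨n % 9, Nat.mod_lt _ (by norm_num), by rw [hs, μ_pow_mod n], hT⟩

/-- **`(ℚ(ζ₉); S)` is a CM type**: an embedding lies in `S` iff its complex conjugate (exponent `8a = −a`) does
not. [cite: Shimura1998, §8.4 Example (1), p. 64] -/
theorem typeSet_isCMType (s : K9 →+* ℂ) : s ∈ typeSet ↔ ComplexEmbedding.conjugate s ∉ typeSet := by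
  obtain ⟨a, ha, hac, hsa⟩ := exists_apply_ζ_eq s
  have h8 : ComplexEmbedding.conjugate s ζ = μ ^ (8 * a) := by
    rw [ComplexEmbedding.conjugate_coe_eq, hsa, map_pow, conj_μ, ← pow_mul]
  rw [mem_typeSet_iff hsa, mem_typeSet_iff h8]
  exact core_conj a ha hac

/-- **The CM type `(ℚ(ζ₉); {φ₁, φ₂, φ₄})`** as a `Motives.CMType`. [cite: Shimura1998, §8.4 Example (1), p. 64] -/
def Φ : CMType K9 := ⟨typeSet, typeSet_isCMType⟩

/-- **The CM type `(ℚ(ζ₉); {φ₁, φ₂, φ₄})` is PRIMITIVE** (Shimura 1998 §8.2 Prop. 26 with `H₁ = {1}`,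
`H' = {γ : γT = T} = {1}` by `core_prim`), in the `Aut(ℂ)`-form consumed by the tree's simplicity criterion
`ComplexMultiplication.isSimple_of_isCMTypeRealisation_of_primitive`: two complex embeddings `s, t` with
`τ ∘ s ∈ S ⟺ τ ∘ t ∈ S` for all `τ ∈ Aut(ℂ)` coincide. Proof as in `Cyclotomic13.Φ_primitive`: exponents `a, b`;
moving `s` to `ζ ↦ μ^{ca}` by some `τ ∈ Aut(ℂ)` (`exists_ringEquiv_comp_eq`) reads the hypothesis as
`ca ∈ T ⟺ cb ∈ T` for every unit `c`, so `a = b` (`core_prim`) and `s = t` (`ringHom_ext_ζ`).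
[cite: Shimura1998, §8.2 Prop. 26, p. 61; §8.4 Example (1), p. 64] -/
theorem Φ_primitive (s t : K9 →+* ℂ)
    (hst : ∀ τ : ℂ ≃+* ℂ, ((τ : ℂ →+* ℂ).comp s ∈ Φ.1 ↔ (τ : ℂ →+* ℂ).comp t ∈ Φ.1)) : s = t := by
  obtain ⟨a, ha, hac, hsa⟩ := exists_apply_ζ_eq s
  obtain ⟨b, hb, hbc, htb⟩ := exists_apply_ζ_eq t
  -- `t ζ` is a power of `s ζ`
  obtain ⟨k, hk⟩ : ∃ k : ℕ, (a * k) % 9 = b := ⟨a ^ 5 * b % 9, core_inv a ha hac b hb⟩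
  have htζ : t ζ = (s ζ) ^ k := by
    rw [htb, hsa, ← pow_mul, μ_pow_mod (a * k), hk]
  -- the pattern hypothesis, read on exponents
  have key : ∀ c : ℕ, c < 9 → c.Coprime 9 → ((c * a) % 9 ∈ expT ↔ (c * b) % 9 ∈ expT) := by
    intro c hc hcc
    obtain ⟨s', hs'⟩ := exists_embedding_apply_ζ_eq (core_coprime c hc hcc a ha hac)
    obtain ⟨τ, hτ⟩ := exists_ringEquiv_comp_eq s s'
    have h1 : ((τ : ℂ →+* ℂ).comp s) ζ = μ ^ (c * a) := by
      simp only [RingHom.coe_comp, RingHom.coe_coe, Function.comp_apply, hτ, hs']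
    have h2 : ((τ : ℂ →+* ℂ).comp t) ζ = μ ^ (c * a * k) := by
      simp only [RingHom.coe_comp, RingHom.coe_coe, Function.comp_apply, htζ, map_pow, hτ, hs', ← pow_mul]
    have hmod : (c * a * k) % 9 = (c * b) % 9 := by
      rw [mul_assoc, Nat.mul_mod, hk, Nat.mul_mod c b, Nat.mod_eq_of_lt hb]
    have hτst := hst τ
    change ((τ : ℂ →+* ℂ).comp s ∈ typeSet ↔ (τ : ℂ →+* ℂ).comp t ∈ typeSet) at hτst
    rw [mem_typeSet_iff h1, mem_typeSet_iff h2, hmod] at hτst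
    exact hτst
  have hab : a = b := core_prim a ha hac b hb hbc key
  exact ringHom_ext_ζ (by rw [hsa, htb, hab])

/-- **The same, in the tree's group-theoretic sense**: for any base embedding `s₀`, the type is
`IsPrimitive (ℂ ≃+* ℂ) Φ s₀` (Shimura's `H₁ = H'`, `ReflexType.IsPrimitive`), via the tree's
`isPrimitive_ringEquiv_complex_iff`. [cite: Shimura1998, §8.2 Prop. 26, p. 61] -/
theorem isPrimitive_Φ (s₀ : K9 →+* ℂ) :
    Literature.NumberTheory.ComplexMultiplication.IsPrimitive (ℂ ≃+* ℂ) Φ.1 s₀ :=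
  (isPrimitive_ringEquiv_complex_iff Φ s₀).2 Φ_primitive

/-! ### The cube root of unity `ω = ζ³ ∈ ℚ(ζ₉)` -/

/-- `ω := ζ³ ∈ ℚ(ζ₉)` is a primitive cube root of unity (`ζ` has order `9 = 3 · 3`), so `ℚ(ζ₉) ⊃ ℚ(ω) = ℚ(√-3)`
and `(2ω + 1)² = -3`. [folklore] -/
theorem isPrimitiveRoot_zeta3 : IsPrimitiveRoot (ζ ^ 3) 3 :=
  isPrimitiveRoot_ζ.pow (by norm_num) (show (9 : ℕ) = 3 * 3 by norm_num)

end Cyclotomic9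

end Summit.HodgeConjecture.HodgeConjecture.Ring2.Atlas

end
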